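import Summits.RiemannHypothesis.RiemannHypothesis.Theorems.WeilBlockLegendreInverse
import Summits.RiemannHypothesis.RiemannHypothesis.Theorems.WeilBlockHpLegendreCoeff
import Literature.NumberTheory.LFunctions.WeilBlockRowsPZ
import HarnessLib

/-!
# The inverse Legendre table of a block certificate, computed — no `D` data, no `D C = I` row files

Sequel of `WeilBlockLegendreInverse.lean` (closed form `a(n,l)` of the coefficient of `P_l` in `x^n`) and of
`WeilBlockHpLegendreCoeff.lean` (B g9: `legendreCoeffQ`, `legendreTable`).  For a `WeilCert` whose change of basis is the
plain Legendre table (`c.Cb p = legendreTable p nb`) and whose inverse block is DEFINED as `c.Db p = legendreInvTable p nb`: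

* `checkDCRows_of_legendreInv` — every row of `D C = I` holds (a theorem; nothing for the kernel to evaluate);
* `legendreInvTableS p nb` — the COLUMN-RESCALED inverse `ã(2k+p, 2i+p) = a(…)/2^{2i+p}` generated by two rational
  recurrences (kernel-cheap, and free of the `≥ 64 trailing zero bits` literals that make `D` itself poisonous for the
  kernel caches, cf. B g9's DnS lever), `legendreInvScales p nb = [1/2^{2i+p}]`, and
  `checkDnRows_of_legendreInv` — the factored-inverse claim rows `D_{ki} = DnS_{ki}/LsS_i` hold for these tables (a theorem).

So a future certificate needs neither `DE/DO` data modules nor `DCE*/DCO*` row files nor `DnRows` claim files for its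
Legendre part; the dominance rows keep using (a literal copy of) `legendreInvTableS` as before.  [folklore]
-/

set_option linter.dupNamespace false

open Finset
open scoped Nat

namespace Summit.RiemannHypothesis.RiemannHypothesis.Theorems.LegendreInverse

open Literature.Analysis.SpecialFunctions Literature.NumberTheory.LFunctions
open Summit.RiemannHypothesis.RiemannHypothesis.Theorems.HpLegendre

/-! ## The column-rescaled coefficients `ã(n,l) = a(n,l)/2^l` and their recurrences -/

/-- `ã(n,l) = (2l+1) n! ((n+l)/2)! / (((n−l)/2)! (n+l+1)!)` (`l ≤ n`, `n + l` even; else `0`). [folklore] -/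
def legendreInvCoeffSQ (n l : ℕ) : ℚ :=
  if l ≤ n ∧ Even (n + l) then
    (((2 * l + 1) * n ! * ((n + l) / 2)! : ℕ) : ℚ) / ((((n - l) / 2)! * (n + l + 1)! : ℕ) : ℚ)
  else 0

/-- `a(n,l) = ã(n,l) · 2^l`. [folklore] -/
theorem legendreInvCoeffQ_eq_scaled (n l : ℕ) : legendreInvCoeffQ n l = legendreInvCoeffSQ n l * 2 ^ l := by
  unfold legendreInvCoeffQ legendreInvCoeffSQ
  split_ifs with h
  · push_cast; ring
  · simp

/-- `ã(n,l) = 0` for `l > n`. [folklore] -/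
theorem legendreInvCoeffSQ_eq_zero_of_lt {n l : ℕ} (h : n < l) : legendreInvCoeffSQ n l = 0 := by
  unfold legendreInvCoeffSQ; rw [if_neg (by omega)]

/-- The in-row recurrence `ã(n, l+2) = ã(n,l) · (2l+5)(n−l) / (4(2l+1)(n+l+3))`. [folklore] -/
theorem legendreInvCoeffSQ_step (n l : ℕ) :
    legendreInvCoeffSQ n (l + 2) =
      legendreInvCoeffSQ n l * (((2 * (l : ℚ) + 5) * ((n : ℚ) - l)) / (4 * (2 * (l : ℚ) + 1) * ((n : ℚ) + l + 3))) := by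
  by_cases hpar : Even (n + l)
  · by_cases hl : l + 2 ≤ n
    · -- the generic case: factorial algebra
      obtain ⟨s, hs⟩ := hpar
      obtain ⟨v, hv⟩ : ∃ v, n = l + 2 * v := ⟨s - l, by omega⟩
      have hv1 : 1 ≤ v := by omega
      obtain ⟨w, rfl⟩ : ∃ w, v = w + 1 := ⟨v - 1, by omega⟩
      have e1 : (n + l) / 2 = l + w + 1 := by omega
      have e2 : (n - l) / 2 = w + 1 := by omega
      have e3 : (n + (l + 2)) / 2 = l + w + 2 := by omega
      have e4 : (n - (l + 2)) / 2 = w := by omega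
      have e5 : n + (l + 2) + 1 = (n + l + 1) + 1 + 1 := by omega
      unfold legendreInvCoeffSQ
      rw [if_pos ⟨hl, ⟨s + 1, by omega⟩⟩, if_pos ⟨by omega, ⟨s, hs⟩⟩, e1, e2, e3, e4, e5]
      have f1 : ((l + w + 2)! : ℚ) = (l + w + 2) * ((l + w + 1)! : ℚ) := by
        rw [show l + w + 2 = (l + w + 1) + 1 by ring, Nat.factorial_succ]; push_cast; ring
      have f2 : ((w + 1)! : ℚ) = (w + 1) * (w ! : ℚ) := by
        rw [Nat.factorial_succ]; push_cast; ring
      have f3 : ((n + l + 1 + 1 + 1)! : ℚ) = (n + l + 3) * (n + l + 2) * ((n + l + 1)! : ℚ) := by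
        rw [Nat.factorial_succ, Nat.factorial_succ]; push_cast; ring
      have hn : (n : ℚ) = l + 2 * (w + 1) := by rw [hv]; push_cast; ring
      push_cast
      rw [f1, f2, f3, hn]
      have h1 : ((l + w + 1)! : ℚ) ≠ 0 := by positivity
      have h2 : (w ! : ℚ) ≠ 0 := by positivity
      have h3 : ((n + l + 1)! : ℚ) ≠ 0 := by positivity
      field_simp
      ring
    · -- `l + 2 > n`: the left side vanishes; on the right `n = l` (same parity) gives the factor `n − l = 0`
      rw [legendreInvCoeffSQ_eq_zero_of_lt (by omega)]
      rcases Nat.lt_or_ge n l with h | h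
      · rw [legendreInvCoeffSQ_eq_zero_of_lt h]; simp
      · have : n = l := by
          obtain ⟨s, hs⟩ := hpar; omega
        subst this; simp
  · have h1 : ¬ (l + 2 ≤ n ∧ Even (n + (l + 2))) := by
      rintro ⟨-, s, hs⟩
      exact hpar ⟨s - 1, by omega⟩
    have h2 : ¬ (l ≤ n ∧ Even (n + l)) := fun h ↦ hpar h.2
    unfold legendreInvCoeffSQ
    rw [if_neg h1, if_neg h2]
    simp

/-- Start values `ã(2k+p, p)`: `1/(2k+1)` (`p = 0`), `3/(2(2k+3))` (`p = 1`). [folklore] -/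
def legendreInvStartS (p k : ℕ) : ℚ := if p = 0 then 1 / (2 * (k : ℚ) + 1) else 3 / (2 * (2 * (k : ℚ) + 3))

/-- `ã(2k+p, p) = legendreInvStartS p k` for `p ≤ 1`. [folklore] -/
theorem legendreInvCoeffSQ_start {p : ℕ} (hp : p ≤ 1) (k : ℕ) :
    legendreInvCoeffSQ (2 * k + p) p = legendreInvStartS p k := by
  rcases Nat.le_one_iff_eq_zero_or_eq_one.1 hp with rfl | rfl
  · unfold legendreInvCoeffSQ legendreInvStartS
    rw [if_pos ⟨by omega, ⟨k, by omega⟩⟩, if_pos rfl]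
    have e1 : (2 * k + 0 + 0) / 2 = k := by omega
    have e2 : (2 * k + 0 - 0) / 2 = k := by omega
    have e3 : 2 * k + 0 + 0 + 1 = 2 * k + 1 := by omega
    rw [e1, e2, e3]
    have f1 : ((2 * k + 1)! : ℚ) = (2 * k + 1) * ((2 * k)! : ℚ) := by rw [Nat.factorial_succ]; push_cast; ring
    push_cast
    rw [show 2 * k + 0 = 2 * k by ring, f1]
    have h1 : ((2 * k)! : ℚ) ≠ 0 := by positivity
    have h2 : (k ! : ℚ) ≠ 0 := by positivity
    field_simp
  · unfold legendreInvCoeffSQ legendreInvStartS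
    rw [if_pos ⟨by omega, ⟨k + 1, by omega⟩⟩, if_neg one_ne_zero]
    have e1 : (2 * k + 1 + 1) / 2 = k + 1 := by omega
    have e2 : (2 * k + 1 - 1) / 2 = k := by omega
    have e3 : 2 * k + 1 + 1 + 1 = (2 * k + 1) + 1 + 1 := by omega
    rw [e1, e2, e3]
    have f1 : ((2 * k + 1 + 1 + 1)! : ℚ) = (2 * k + 3) * (2 * k + 2) * ((2 * k + 1)! : ℚ) := by
      rw [Nat.factorial_succ, Nat.factorial_succ]; push_cast; ring
    have f2 : ((k + 1)! : ℚ) = (k + 1) * (k ! : ℚ) := by rw [Nat.factorial_succ]; push_cast; ring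
    push_cast
    rw [f1, f2]
    have h1 : ((2 * k + 1)! : ℚ) ≠ 0 := by positivity
    have h2 : (k ! : ℚ) ≠ 0 := by positivity
    field_simp

/-! ## The tables -/

/-- `[ã(n,l), ã(n,l+2), …]` (`N` entries) generated from `ã(n,l) = a` by the in-row recurrence. [folklore] -/
def legendreInvRowFrom (n : ℕ) : ℕ → ℚ → ℕ → List ℚ
  | _, _, 0 => []
  | l, a, N + 1 => a :: legendreInvRowFrom n (l + 2)
      (a * (((2 * (l : ℚ) + 5) * ((n : ℚ) - l)) / (4 * (2 * (l : ℚ) + 1) * ((n : ℚ) + l + 3)))) N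

/-- The generated row has the requested length. [folklore] -/
theorem length_legendreInvRowFrom (n : ℕ) : ∀ (N l : ℕ) (a : ℚ), (legendreInvRowFrom n l a N).length = N
  | 0, _, _ => rfl
  | N + 1, l, a => by rw [legendreInvRowFrom, List.length_cons, length_legendreInvRowFrom n N]

/-- Entries of the generated row started at `ã(n, l)`: entry `i` is `ã(n, l + 2i)`. [folklore] -/
theorem getD_legendreInvRowFrom (n : ℕ) : ∀ (N l i : ℕ), i < N →
    (legendreInvRowFrom n l (legendreInvCoeffSQ n l) N).getD i 0 = legendreInvCoeffSQ n (l + 2 * i)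
  | 0, _, _, h => absurd h (Nat.not_lt_zero _)
  | N + 1, l, 0, _ => by rw [legendreInvRowFrom, List.getD_cons_zero, mul_zero, add_zero]
  | N + 1, l, i + 1, h => by
      rw [legendreInvRowFrom, List.getD_cons_succ, ← legendreInvCoeffSQ_step n l,
        getD_legendreInvRowFrom n N (l + 2) i (by omega), show l + 2 + 2 * i = l + 2 * (i + 1) by ring]

/-- **The column-rescaled inverse table** (`DnS`): row `k < N` = `[ã(2k+p, p), ã(2k+p, p+2), …, ã(2k+p, 2k+p)]`. [folklore] -/
def legendreInvTableS (p N : ℕ) : List (List ℚ) :=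
  (List.range N).map fun k ↦ legendreInvRowFrom (2 * k + p) p (legendreInvStartS p k) (k + 1)

/-- Entries of `legendreInvTableS`: `ã(2k+p, 2i+p)` for `k < N` (zero beyond the triangle). [folklore] -/
theorem getM_legendreInvTableS {p : ℕ} (hp : p ≤ 1) {N k : ℕ} (hk : k < N) (i : ℕ) :
    getM (legendreInvTableS p N) k i = legendreInvCoeffSQ (2 * k + p) (2 * i + p) := by
  unfold getM legendreInvTableS
  have hrow : ((List.range N).map fun k ↦ legendreInvRowFrom (2 * k + p) p (legendreInvStartS p k) (k + 1)).getD k []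
      = legendreInvRowFrom (2 * k + p) p (legendreInvStartS p k) (k + 1) := by
    rw [List.getD_eq_getElem?_getD, List.getElem?_map, List.getElem?_range hk, Option.map_some, Option.getD_some]
  rw [hrow, ← legendreInvCoeffSQ_start hp k]
  by_cases hi : i < k + 1
  · rw [getD_legendreInvRowFrom _ _ _ _ hi, show p + 2 * i = 2 * i + p by ring]
  · rw [List.getD_eq_default _ _ (by rw [length_legendreInvRowFrom]; omega),
      legendreInvCoeffSQ_eq_zero_of_lt (by omega)]

/-- **The scales** `LsS_i = 1/2^{2i+p}`. [folklore] -/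
def legendreInvScales (p N : ℕ) : List ℚ := (List.range N).map fun i ↦ (1 : ℚ) / 2 ^ (2 * i + p)

/-- Entries of the scales. [folklore] -/
theorem getV_legendreInvScales (p : ℕ) {N i : ℕ} (hi : i < N) :
    getV (legendreInvScales p N) i = 1 / 2 ^ (2 * i + p) := by
  unfold getV legendreInvScales
  rw [List.getD_eq_getElem?_getD, List.getElem?_map, List.getElem?_range hi, Option.map_some, Option.getD_some]

/-- **The inverse change of basis** `D`: row `k < N` = `[a(2k+p, p), …, a(2k+p, 2k+p)]` (for DEFINING `WeilCert.DE/DO`; it is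
reasoned about, never evaluated — its literals would have `≥ 64` trailing zero bits). [folklore] -/
def legendreInvTable (p N : ℕ) : List (List ℚ) :=
  (List.range N).map fun k ↦ (List.range (k + 1)).map fun i ↦ legendreInvCoeffQ (2 * k + p) (2 * i + p)

/-- Entries of `legendreInvTable`: `a(2k+p, 2i+p)` for `k < N`. [folklore] -/
theorem getM_legendreInvTable (p : ℕ) {N k : ℕ} (hk : k < N) (i : ℕ) :
    getM (legendreInvTable p N) k i = legendreInvCoeffQ (2 * k + p) (2 * i + p) := by
  unfold getM legendreInvTable
  have hrow : ((List.range N).map fun k ↦ (List.range (k + 1)).map fun i ↦ legendreInvCoeffQ (2 * k + p) (2 * i + p)).getD k []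
      = (List.range (k + 1)).map fun i ↦ legendreInvCoeffQ (2 * k + p) (2 * i + p) := by
    rw [List.getD_eq_getElem?_getD, List.getElem?_map, List.getElem?_range hk, Option.map_some, Option.getD_some]
  rw [hrow]
  by_cases hi : i < k + 1
  · rw [List.getD_eq_getElem?_getD, List.getElem?_map, List.getElem?_range hi, Option.map_some, Option.getD_some]
  · rw [List.getD_eq_default _ _ (by simpa using hi), legendreInvCoeffQ_eq_zero_of_lt (by omega)]

/-! ## The certificate's rows -/

/-- `Σ_{k<N} a(2i+p,2k+p) c(2k+p,2j+p) = [i = j]` over `ℚ` (`i, j < N`). [folklore] -/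
theorem sum_legendreInvCoeffQ_mul_legendreCoeffQ {p : ℕ} (hp : p ≤ 1) {N i j : ℕ} (hi : i < N) (hj : j < N) :
    ∑ k ∈ range N, legendreInvCoeffQ (2 * i + p) (2 * k + p) * legendreCoeffQ (2 * k + p) (2 * j + p) =
      if i = j then 1 else 0 := by
  apply Rat.cast_injective (α := ℝ)
  have h := sum_legendreInvCoeff_mul_coeff hp hi hj
  simp_rw [coeff_legendre] at h
  push_cast
  rw [h]
  split_ifs <;> simp

/-- **Every row of `D C = I` holds** when `C` is the Legendre table and `D` the inverse table (entrywise hypotheses).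
[folklore] -/
theorem checkDCRows_of_legendreInv_entries (c : WeilCert) {p : ℕ} (hp : p ≤ 1)
    (hC : ∀ k < c.nb, ∀ j, getM (c.Cb p) k j = legendreCoeffQ (2 * k + p) (2 * j + p))
    (hD : ∀ i < c.nb, ∀ k, getM (c.Db p) i k = legendreInvCoeffQ (2 * i + p) (2 * k + p)) :
    ∀ i < c.nb, c.checkDCRow p i = true := by
  intro i hi
  unfold WeilCert.checkDCRow
  refine WeilCert2.allBelow_of_forall fun j hj ↦ ?_
  rw [decide_eq_true_eq, sumR_eq_sum,
    Finset.sum_congr rfl fun k hk ↦ by rw [hD i hi k, hC k (Finset.mem_range.1 hk) j]]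
  exact sum_legendreInvCoeffQ_mul_legendreCoeffQ hp hi hj

/-- **Every row of `D C = I` holds** for `c.Cb p = legendreTable p nb`, `c.Db p = legendreInvTable p nb`. [folklore] -/
theorem checkDCRows_of_legendreInv (c : WeilCert) {p : ℕ} (hp : p ≤ 1)
    (hC : c.Cb p = legendreTable p c.nb) (hD : c.Db p = legendreInvTable p c.nb) :
    ∀ i < c.nb, c.checkDCRow p i = true :=
  checkDCRows_of_legendreInv_entries c hp (fun k hk j ↦ by rw [hC]; exact getM_legendreTable hp hk j)
    (fun i hi k ↦ by rw [hD]; exact getM_legendreInvTable p hi k)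

/-- **The factored-inverse claim rows** `D_{ki} = DnS_{ki}/LsS_i` hold for `DnS = legendreInvTableS`, `LsS = legendreInvScales`
when `c.Db p = legendreInvTable p nb`. [folklore] -/
theorem checkDnRows_of_legendreInv (c : WeilCert) {p : ℕ} (hp : p ≤ 1) (hD : c.Db p = legendreInvTable p c.nb) :
    ∀ k < c.nb, c.checkDnRow (legendreInvTableS p c.nb) (legendreInvScales p c.nb) p k = true := by
  intro k hk
  unfold WeilCert.checkDnRow
  refine WeilCert2.allBelow_of_forall fun i hi ↦ ?_
  rw [decide_eq_true_eq, getV_legendreInvScales p hi, hD, getM_legendreInvTable p hk, getM_legendreInvTableS hp hk,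
    legendreInvCoeffQ_eq_scaled]
  refine ⟨by positivity, ?_⟩
  field_simp

/-- Same, with `DnS`/`LsS` given as literal copies of the computed tables (what a generated certificate does). [folklore] -/
theorem checkDnRows_of_legendreInv_data (c : WeilCert) {p : ℕ} (hp : p ≤ 1) (hD : c.Db p = legendreInvTable p c.nb)
    {DnS : List (List ℚ)} {LsS : List ℚ} (hDn : DnS = legendreInvTableS p c.nb) (hLs : LsS = legendreInvScales p c.nb) :
    ∀ k < c.nb, c.checkDnRow DnS LsS p k = true := by
  subst hDn hLs; exact checkDnRows_of_legendreInv c hp hD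

/-- kernel sanity check: the first rows of the rescaled even table, `ã(2k, 2i) = a(2k,2i)/4^i`. -/
example : legendreInvTableS 0 3 = [[1], [1/3, 1/6], [1/5, 1/7, 1/70]] := by decide +kernel

/-- kernel sanity check: odd table `ã(2k+1, 2i+1) = a/2^{2i+1}`: `x = P₁`, `x³ = (3/5)P₁ + (2/5)P₃`. -/
example : legendreInvTableS 1 2 = [[1/2], [3/10, 1/20]] := by decide +kernel

end Summit.RiemannHypothesis.RiemannHypothesis.Theorems.LegendreInverse

-- build note (sr-gb-rung-b B g14, 2026-08-24T19:45Z): comment-only re-land under the LEAD LOCATED EXCEPTION to R15-0 (2a) (rh-explicit INBOX l.5563 / OPS-REQUESTS 19:02Z, class (ii): accepted through the gate deferred->retry path, never enqueued for the post-accept build); all declarations above are byte-identical to the accepted file.
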